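import Mathlib.Data.Matrix.Block
import Mathlib.LinearAlgebra.Matrix.Adjugate
import Mathlib.LinearAlgebra.Matrix.NonsingularInverse
import Mathlib.LinearAlgebra.Matrix.GeneralLinearGroup.Defs
import Mathlib.LinearAlgebra.Matrix.Reindex
import Mathlib.Algebra.Module.Torsion.Field
import Mathlib.NumberTheory.Padics.Complex
import Mathlib.Tactic.FinCases
import Mathlib.Tactic.NormNum
import Summits.Langlands.Langlands.Theorems.PhantomRMYoshidaResiduallyYoshidaLiftingAdjugateDualCocycle
import Summits.Langlands.Langlands.Theorems.ResiduallyYoshidaLifting.Negative.ShLagrangianDuality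
import HarnessLib

/-!
# The dual integral frame (stub `stub_dualFrameRealisation`) — line `sector-klingen-split`,
# crux `ResiduallyYoshidaLifting` (stmt-Langlands-13639)

Stub-worker of lead prover-line-stmt-Langlands-13639-c5-0 (2026-08-17), skeleton rev 13, sub-goal D1.

Let `rint = P⁻¹ r P : Γ → GL₄(ℤ̄_p)` be an integral frame of `r : Γ → GL₄(ℚ̄_p)` whose reduction through
`red : ℤ̄_p → k` is `h (σ̄, B; 0, σ̄') h⁻¹` (blocks transported along `finSumFinEquiv`), let `r` be symplectic,
`r(g)ᵀ J r(g) = ν(g) J` with `det J ≠ 0`, and let every `ν(g)` have an integral lift `u_g` reducing to the common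
determinant `d(g)` of `σ̄(g), σ̄'(g)`.  Then the DUAL FRAME `rint₂(g) := u_g · (rint g)⁻ᵀ` is an integral frame of the SAME
`r`, with conjugator `P₂ = J⁻¹ P⁻ᵀ`, and its reduction is `h₂ (σ̄', B'; 0, σ̄) h₂⁻¹` in the OPPOSITE orientation with the
adjugate-dual cocycle `B'(g) = -d(g)⁻¹ • (σ̄'(g) · adj(B g) · σ̄(g))` and `h₂ = h⁻ᵀ · E`, `E` the transport of the block matrix
`(0, J₂; J₂, 0)`, `J₂ = (0, 1; -1, 0)`.

Proof.
* `ν` is multiplicative (`ν(gg') J = r(g')ᵀ (r(g)ᵀ J r(g)) r(g') = ν(g) ν(g') J`, `J ≠ 0`) with `ν(1) = 1`, so the lift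
  `u` (unique by injectivity of `ℤ̄_p → ℚ̄_p`) is multiplicative with `u_1 = 1`; hence `g ↦ u_g · (rint g)⁻ᵀ` is a monoid
  homomorphism `Γ → M₄(ℤ̄_p)`, which lands in `GL₄(ℤ̄_p)` (`MonoidHom.toHomUnits`).
* Over `ℚ̄_p`: `rᵀ J r = ν J` gives `J r J⁻¹ = ν · r⁻ᵀ`, so `ν · (P⁻¹ r P)⁻ᵀ = Pᵀ (ν r⁻ᵀ) P⁻ᵀ = (Pᵀ J) r (J⁻¹ P⁻ᵀ)`.
* Over `k`: the reduction of `rint₂(g)` is `d(g) · Yᵀ` with `Y = red((rint g)⁻¹)` the inverse of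
  `X = red(rint g) = h M h⁻¹`, `M` the transport of `(S, B; 0, S')` (`S = σ̄(g)`, `S' = σ̄'(g)`).  With `J₂' = J₂⁻¹ = (0, -1; 1, 0)`
  (`J₂ J₂' = 1`: the landed `J₂_mul_J₂'` of `…Negative.ShLagrangianDuality`) one has `J₂' Aᵀ J₂ = adj A` on `M₂`, whence
  the block identities
  `(0, J₂'; J₂', 0) Mᵀ (0, J₂; J₂, 0) = (adj S', adj B; 0, adj S)` and
  `(S', B'; 0, S) (adj S', adj B; 0, adj S) = d • 1` (`S adj S = d`, `B' adj S = -S' adj B`), so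
  `E N E' Mᵀ = d • 1` for `N` the transport of `(S', B'; 0, S)`, `E' = E⁻¹`; therefore `Z := h⁻ᵀ E N E' hᵀ` satisfies
  `Z Xᵀ = d • 1`, and `Z = Z Xᵀ Yᵀ = d • Yᵀ`.

Pure Mathlib matrix algebra (blocks, adjugate, nonsingular inverse, reindexing); no named facts.
-/

noncomputable section

set_option linter.dupNamespace false
set_option autoImplicit false

open scoped Matrix

namespace Summit.Langlands.Langlands.Cruxes.ResiduallyYoshidaLifting.SectorKlingenSplit.Fibre

open Summit.Langlands.Langlands.Theorems.ResiduallyYoshidaLifting.Negative (J₂_mul_J₂')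

/-! ## A `2 × 2` fact: `J₂⁻¹ Aᵀ J₂ = adj A` (companion of the landed `J₂_mul_mul_J₂inv_eq_adjugate_transpose`) -/

/-- On `2 × 2` matrices, `J₂' Aᵀ J₂ = adj A` for `J₂ = (0, 1; -1, 0)` and `J₂' = J₂⁻¹ = (0, -1; 1, 0)`. [folklore] -/
theorem J₂inv_mul_transpose_mul_J₂ {R : Type*} [CommRing R] (A : Matrix (Fin 2) (Fin 2) R) :
    !![(0 : R), -1; 1, 0] * Aᵀ * !![(0 : R), 1; -1, 0] = A.adjugate := by
  rw [Matrix.adjugate_fin_two, Matrix.eta_fin_two Aᵀ, Matrix.mul_fin_two, Matrix.mul_fin_two]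
  ext i j
  fin_cases i <;> fin_cases j <;> simp

/-! ## Block identities behind the dual frame -/

/-- The block swap-twist matrices `(0, J₂; J₂, 0)` and `(0, J₂'; J₂', 0)` are mutually inverse as soon as
`J₂ J₂' = 1`. [folklore] -/
theorem swapTwist_mul_swapTwist {R : Type*} [CommRing R] (J₂ J₂' : Matrix (Fin 2) (Fin 2) R)
    (hJ : J₂ * J₂' = 1) :
    Matrix.fromBlocks 0 J₂ J₂ 0 * Matrix.fromBlocks 0 J₂' J₂' 0 = 1 := by
  rw [Matrix.fromBlocks_multiply, ← Matrix.fromBlocks_one]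
  simp [hJ]

/-- Conjugating the transpose of a block upper-triangular `(S, B; 0, S')` by the swap-twist gives the block
upper-triangular matrix of adjugates in the OPPOSITE orientation:
`(0, J₂'; J₂', 0) (S, B; 0, S')ᵀ (0, J₂; J₂, 0) = (adj S', adj B; 0, adj S)` (from `J₂' Aᵀ J₂ = adj A`). [folklore] -/
theorem swapTwist_conj_transpose {R : Type*} [CommRing R] (J₂ J₂' S S' B : Matrix (Fin 2) (Fin 2) R)
    (hadj : ∀ A : Matrix (Fin 2) (Fin 2) R, J₂' * Aᵀ * J₂ = A.adjugate) :
    Matrix.fromBlocks 0 J₂' J₂' 0 * (Matrix.fromBlocks S B 0 S')ᵀ * Matrix.fromBlocks 0 J₂ J₂ 0 =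
      Matrix.fromBlocks S'.adjugate B.adjugate 0 S.adjugate := by
  rw [Matrix.fromBlocks_transpose, Matrix.fromBlocks_multiply, Matrix.fromBlocks_multiply]
  simp only [Matrix.transpose_zero, Matrix.zero_mul, Matrix.mul_zero, zero_add, add_zero, hadj]

/-- The dual block matrix times the matrix of adjugates is the scalar `d`:
`(S', B'; 0, S) (adj S', adj B; 0, adj S) = d • 1` for `B' = -d⁻¹ • (S' adj B S)`, `det S = det S' = d`
(`S adj S = d • 1`, `B' adj S = -S' adj B`). [folklore] -/
theorem dualBlock_mul_adjugateBlock {R : Type*} [CommRing R] (S S' B : Matrix (Fin 2) (Fin 2) R) (d : Rˣ)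
    (hS : S.det = d) (hS' : S'.det = d) :
    Matrix.fromBlocks S' (-((d⁻¹ : Rˣ) : R) • (S' * B.adjugate * S)) 0 S *
        Matrix.fromBlocks S'.adjugate B.adjugate 0 S.adjugate = (d : R) • 1 := by
  have h12 : S' * B.adjugate + -((d⁻¹ : Rˣ) : R) • (S' * B.adjugate * S) * S.adjugate = 0 := by
    rw [Matrix.smul_mul, Matrix.mul_assoc _ S, Matrix.mul_adjugate, hS, Matrix.mul_smul, Matrix.mul_one,
      smul_smul, neg_mul, Units.inv_mul, neg_smul, one_smul, add_neg_cancel]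
  rw [Matrix.fromBlocks_multiply]
  simp only [Matrix.zero_mul, Matrix.mul_zero, zero_add, add_zero]
  rw [Matrix.mul_adjugate, Matrix.mul_adjugate, hS, hS', h12, ← Matrix.fromBlocks_one, Matrix.fromBlocks_smul,
    smul_zero]

/-- The block identity of the dual frame: `E N E' Mᵀ = d • 1` for `M = (S, B; 0, S')`, `N = (S', B'; 0, S)` with
`B' = -d⁻¹ • (S' adj B S)`, `E = (0, J₂; J₂, 0)`, `E' = (0, J₂'; J₂', 0)`. [folklore] -/
theorem dualBlock_identity {R : Type*} [CommRing R] (J₂ J₂' S S' B : Matrix (Fin 2) (Fin 2) R) (d : Rˣ)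
    (hadj : ∀ A : Matrix (Fin 2) (Fin 2) R, J₂' * Aᵀ * J₂ = A.adjugate) (hJ : J₂ * J₂' = 1)
    (hS : S.det = d) (hS' : S'.det = d) :
    Matrix.fromBlocks 0 J₂ J₂ 0 * Matrix.fromBlocks S' (-((d⁻¹ : Rˣ) : R) • (S' * B.adjugate * S)) 0 S *
        Matrix.fromBlocks 0 J₂' J₂' 0 * (Matrix.fromBlocks S B 0 S')ᵀ = (d : R) • 1 := by
  have hEE' := swapTwist_mul_swapTwist J₂ J₂' hJ
  calc Matrix.fromBlocks 0 J₂ J₂ 0 * Matrix.fromBlocks S' (-((d⁻¹ : Rˣ) : R) • (S' * B.adjugate * S)) 0 S *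
        Matrix.fromBlocks 0 J₂' J₂' 0 * (Matrix.fromBlocks S B 0 S')ᵀ
      = Matrix.fromBlocks 0 J₂ J₂ 0 * Matrix.fromBlocks S' (-((d⁻¹ : Rˣ) : R) • (S' * B.adjugate * S)) 0 S *
          Matrix.fromBlocks 0 J₂' J₂' 0 * (Matrix.fromBlocks S B 0 S')ᵀ *
          (Matrix.fromBlocks 0 J₂ J₂ 0 * Matrix.fromBlocks 0 J₂' J₂' 0) := by
        rw [hEE', Matrix.mul_one]
    _ = Matrix.fromBlocks 0 J₂ J₂ 0 * (Matrix.fromBlocks S' (-((d⁻¹ : Rˣ) : R) • (S' * B.adjugate * S)) 0 S *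
          (Matrix.fromBlocks 0 J₂' J₂' 0 * (Matrix.fromBlocks S B 0 S')ᵀ * Matrix.fromBlocks 0 J₂ J₂ 0)) *
          Matrix.fromBlocks 0 J₂' J₂' 0 := by
        simp only [Matrix.mul_assoc]
    _ = (d : R) • 1 := by
        rw [swapTwist_conj_transpose J₂ J₂' S S' B hadj, dualBlock_mul_adjugateBlock S S' B d hS hS',
          Matrix.mul_smul, Matrix.mul_one, Matrix.smul_mul, hEE']

/-! ## The same identities after transport along `e : Fin 2 ⊕ Fin 2 ≃ ι` -/

/-- Transport of `swapTwist_mul_swapTwist`: `E E' = 1` for the reindexed swap-twists. [folklore] -/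
theorem reindex_swapTwist_mul {R : Type*} [CommRing R] {ι : Type*} [Fintype ι] [DecidableEq ι]
    (e : Fin 2 ⊕ Fin 2 ≃ ι) (J₂ J₂' : Matrix (Fin 2) (Fin 2) R) (hJ : J₂ * J₂' = 1) :
    Matrix.reindex e e (Matrix.fromBlocks 0 J₂ J₂ 0) * Matrix.reindex e e (Matrix.fromBlocks 0 J₂' J₂' 0) = 1 := by
  simp only [Matrix.reindex_apply, Matrix.submatrix_mul_equiv, swapTwist_mul_swapTwist J₂ J₂' hJ,
    Matrix.submatrix_one_equiv]

/-- Transport of `dualBlock_identity` along `e : Fin 2 ⊕ Fin 2 ≃ ι`: `E N E' Mᵀ = d • 1` for the reindexed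
matrices. [folklore] -/
theorem reindex_dualBlock_identity {R : Type*} [CommRing R] {ι : Type*} [Fintype ι] [DecidableEq ι]
    (e : Fin 2 ⊕ Fin 2 ≃ ι) (J₂ J₂' S S' B : Matrix (Fin 2) (Fin 2) R) (d : Rˣ)
    (hadj : ∀ A : Matrix (Fin 2) (Fin 2) R, J₂' * Aᵀ * J₂ = A.adjugate) (hJ : J₂ * J₂' = 1)
    (hS : S.det = d) (hS' : S'.det = d) :
    Matrix.reindex e e (Matrix.fromBlocks 0 J₂ J₂ 0) *
        Matrix.reindex e e (Matrix.fromBlocks S' (-((d⁻¹ : Rˣ) : R) • (S' * B.adjugate * S)) 0 S) *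
        Matrix.reindex e e (Matrix.fromBlocks 0 J₂' J₂' 0) *
        (Matrix.reindex e e (Matrix.fromBlocks S B 0 S'))ᵀ = (d : R) • 1 := by
  have h := dualBlock_identity J₂ J₂' S S' B d hadj hJ hS hS'
  simp only [Matrix.reindex_apply, Matrix.transpose_submatrix, Matrix.submatrix_mul_equiv, h,
    Matrix.submatrix_smul, Pi.smul_apply, Matrix.submatrix_one_equiv]

/-- **The residual dual frame.**  If `X = h M h'` with `h h' = h' h = 1`, `M` the transport of `(S, B; 0, S')`
(`det S = det S' = d`), and `Y X = 1`, then `d • Yᵀ = h₂ N h₂'` with `N` the transport of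
`(S', -d⁻¹ • (S' adj B S); 0, S)`, `h₂ = h'ᵀ E`, `h₂' = E' hᵀ`: indeed `Z := h₂ N h₂'` has `Z Xᵀ = h'ᵀ (E N E' Mᵀ) hᵀ = d • 1`
and `Z = Z Xᵀ Yᵀ`. [folklore] -/
theorem residual_dualFrame {R : Type*} [CommRing R] {ι : Type*} [Fintype ι] [DecidableEq ι]
    (e : Fin 2 ⊕ Fin 2 ≃ ι) (J₂ J₂' S S' B : Matrix (Fin 2) (Fin 2) R) (d : Rˣ)
    (hadj : ∀ A : Matrix (Fin 2) (Fin 2) R, J₂' * Aᵀ * J₂ = A.adjugate) (hJ : J₂ * J₂' = 1)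
    (hS : S.det = d) (hS' : S'.det = d) (h h' X Y : Matrix ι ι R) (hh' : h * h' = 1) (hh : h' * h = 1)
    (hX : X = h * Matrix.reindex e e (Matrix.fromBlocks S B 0 S') * h') (hYX : Y * X = 1) :
    (d : R) • Yᵀ = h'ᵀ * Matrix.reindex e e (Matrix.fromBlocks 0 J₂ J₂ 0) *
      Matrix.reindex e e (Matrix.fromBlocks S' (-((d⁻¹ : Rˣ) : R) • (S' * B.adjugate * S)) 0 S) *
      (Matrix.reindex e e (Matrix.fromBlocks 0 J₂' J₂' 0) * hᵀ) := by
  have hth' : hᵀ * h'ᵀ = 1 := by rw [← Matrix.transpose_mul, hh, Matrix.transpose_one]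
  have hXt : Xᵀ = h'ᵀ * ((Matrix.reindex e e (Matrix.fromBlocks S B 0 S'))ᵀ * hᵀ) := by
    rw [hX, Matrix.transpose_mul, Matrix.transpose_mul]
  have hZX : h'ᵀ * Matrix.reindex e e (Matrix.fromBlocks 0 J₂ J₂ 0) *
      Matrix.reindex e e (Matrix.fromBlocks S' (-((d⁻¹ : Rˣ) : R) • (S' * B.adjugate * S)) 0 S) *
      (Matrix.reindex e e (Matrix.fromBlocks 0 J₂' J₂' 0) * hᵀ) * Xᵀ = (d : R) • 1 := by
    calc h'ᵀ * Matrix.reindex e e (Matrix.fromBlocks 0 J₂ J₂ 0) *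
          Matrix.reindex e e (Matrix.fromBlocks S' (-((d⁻¹ : Rˣ) : R) • (S' * B.adjugate * S)) 0 S) *
          (Matrix.reindex e e (Matrix.fromBlocks 0 J₂' J₂' 0) * hᵀ) * Xᵀ
        = h'ᵀ * (Matrix.reindex e e (Matrix.fromBlocks 0 J₂ J₂ 0) *
            Matrix.reindex e e (Matrix.fromBlocks S' (-((d⁻¹ : Rˣ) : R) • (S' * B.adjugate * S)) 0 S) *
            Matrix.reindex e e (Matrix.fromBlocks 0 J₂' J₂' 0)) * (hᵀ * h'ᵀ) *
            ((Matrix.reindex e e (Matrix.fromBlocks S B 0 S'))ᵀ * hᵀ) := by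
          rw [hXt]; simp only [Matrix.mul_assoc]
      _ = h'ᵀ * (Matrix.reindex e e (Matrix.fromBlocks 0 J₂ J₂ 0) *
            Matrix.reindex e e (Matrix.fromBlocks S' (-((d⁻¹ : Rˣ) : R) • (S' * B.adjugate * S)) 0 S) *
            Matrix.reindex e e (Matrix.fromBlocks 0 J₂' J₂' 0) *
            (Matrix.reindex e e (Matrix.fromBlocks S B 0 S'))ᵀ) * hᵀ := by
          rw [hth', Matrix.mul_one]; simp only [Matrix.mul_assoc]
      _ = (d : R) • 1 := by
          rw [reindex_dualBlock_identity e J₂ J₂' S S' B d hadj hJ hS hS', Matrix.mul_smul, Matrix.mul_one,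
            Matrix.smul_mul, ← Matrix.transpose_mul, hh', Matrix.transpose_one]
  calc (d : R) • Yᵀ = (d : R) • (1 : Matrix ι ι R) * Yᵀ := by rw [Matrix.smul_mul, Matrix.one_mul]
    _ = h'ᵀ * Matrix.reindex e e (Matrix.fromBlocks 0 J₂ J₂ 0) *
          Matrix.reindex e e (Matrix.fromBlocks S' (-((d⁻¹ : Rˣ) : R) • (S' * B.adjugate * S)) 0 S) *
          (Matrix.reindex e e (Matrix.fromBlocks 0 J₂' J₂' 0) * hᵀ) * (Xᵀ * Yᵀ) := by
        rw [← hZX, Matrix.mul_assoc]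
    _ = _ := by rw [← Matrix.transpose_mul, hYX, Matrix.transpose_one, Matrix.mul_one]

/-! ## Over `ℚ̄_p`: the multiplier and the dual conjugator -/

/-- The multiplier of a similitude representation is multiplicative with `ν(1) = 1`:
`ν(ab) J = r(b)ᵀ (r(a)ᵀ J r(a)) r(b) = ν(a) ν(b) J` and `J ≠ 0`. [folklore] -/
theorem multiplier_mul_one {K : Type*} [Field K] {n : Type*} [Fintype n] [DecidableEq n] {Γ : Type*} [Group Γ]
    (r : Γ →* GL n K) (J : Matrix n n K) (ν : Γ → K) (hJ0 : J ≠ 0)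
    (hsymp : ∀ g, (r g).valᵀ * J * (r g).val = ν g • J) :
    (∀ a b, ν (a * b) = ν a * ν b) ∧ ν 1 = 1 := by
  refine ⟨fun a b => smul_left_injective K hJ0 ?_, smul_left_injective K hJ0 ?_⟩
  · have e1 := hsymp (a * b)
    rw [map_mul, Units.val_mul, Matrix.transpose_mul] at e1
    have e2 : (r b).valᵀ * (r a).valᵀ * J * ((r a).val * (r b).val) = (ν a * ν b) • J := by
      calc (r b).valᵀ * (r a).valᵀ * J * ((r a).val * (r b).val)
          = (r b).valᵀ * ((r a).valᵀ * J * (r a).val) * (r b).val := by simp only [Matrix.mul_assoc]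
        _ = (ν a * ν b) • J := by rw [hsymp a, Matrix.mul_smul, Matrix.smul_mul, hsymp b, smul_smul]
    change ν (a * b) • J = (ν a * ν b) • J
    rw [← e1, e2]
  · have e1 := hsymp 1
    rw [map_one, Units.val_one, Matrix.transpose_one, Matrix.one_mul, Matrix.mul_one] at e1
    change ν 1 • J = (1 : K) • J
    rw [← e1, one_smul]

/-- The dual conjugator over `ℚ̄_p`: if `Rᵀ J R = ν J` (`J` invertible, `R R' = 1`) then `ν · R'ᵀ = J R J⁻¹`, hence
for any frame `P' R' P_m` one has `ν · (P' R' P_m)ᵀ = (P_mᵀ J) R (J⁻¹ P'ᵀ)`. [folklore] -/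
theorem dual_frame_transport {K : Type*} [CommRing K] {n : Type*} [Fintype n] [DecidableEq n]
    (R R' Pm P' J : Matrix n n K) (ν : K) (hJ : IsUnit J.det) (hRR' : R * R' = 1)
    (hsymp : Rᵀ * J * R = ν • J) :
    ν • (P' * R' * Pm)ᵀ = Pmᵀ * J * R * (J⁻¹ * P'ᵀ) := by
  have h1 : J * R = ν • (R'ᵀ * J) := by
    calc J * R = (R * R')ᵀ * (J * R) := by rw [hRR', Matrix.transpose_one, Matrix.one_mul]
      _ = R'ᵀ * (Rᵀ * J * R) := by rw [Matrix.transpose_mul]; simp only [Matrix.mul_assoc]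
      _ = ν • (R'ᵀ * J) := by rw [hsymp, Matrix.mul_smul]
  have h2 : J * R * J⁻¹ = ν • R'ᵀ := by
    rw [h1, Matrix.smul_mul, Matrix.mul_assoc, Matrix.mul_nonsing_inv J hJ, Matrix.mul_one]
  calc ν • (P' * R' * Pm)ᵀ = ν • (Pmᵀ * R'ᵀ * P'ᵀ) := by
        rw [Matrix.transpose_mul, Matrix.transpose_mul, Matrix.mul_assoc]
    _ = Pmᵀ * (J * R * J⁻¹) * P'ᵀ := by rw [h2, Matrix.mul_smul, Matrix.smul_mul]
    _ = Pmᵀ * J * R * (J⁻¹ * P'ᵀ) := by simp only [Matrix.mul_assoc]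

/-! ## The registered stub -/

/-- **Registered sub-goal D1 `stub_dualFrameRealisation`** (skeleton rev 13 of line `sector-klingen-split`): let
`rint = P⁻¹ r P` be an integral frame of `r : Γ → GL₄(ℚ̄_p)` reducing through `red` to `h (σ̄, B; 0, σ̄') h⁻¹`, let `r` be
symplectic, `r(g)ᵀ J r(g) = ν(g) J` (`J` alternating invertible over `ℚ̄_p`), and let the multiplier be integral with
reduction the common determinant `d` of `σ̄, σ̄'`.  Then the DUAL frame `rint₂ := u · rint⁻ᵀ` (`u` the integral lift of `ν`,
conjugator `P₂ = J⁻¹ P⁻ᵀ`) is an integral frame of the SAME `r` whose reduction is `h₂ (σ̄', B'; 0, σ̄) h₂⁻¹` in the OPPOSITE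
orientation, with the adjugate-dual cocycle `B'(g) = -d(g)⁻¹ • σ̄'(g) adj(B g) σ̄(g)` (`J₂⁻¹ Aᵀ J₂ = adj A`, block swap-twist
`h₂ = h⁻ᵀ E`). [folklore] -/
theorem stub_dualFrameRealisation :
    ∀ (p : ℕ) [Fact p.Prime] (k : Type) [Field k] (Γ : Type) [Group Γ]
      (red : Valued.integer (PadicAlgCl p) →+* k) (σ σ' : Γ →* GL (Fin 2) k) (d : Γ → kˣ)
      (B : Γ → Matrix (Fin 2) (Fin 2) k)
      (r : Γ →* GL (Fin 4) (PadicAlgCl p)) (P : GL (Fin 4) (PadicAlgCl p))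
      (rint : Γ →* GL (Fin 4) (Valued.integer (PadicAlgCl p))) (h : GL (Fin 4) k)
      (J : Matrix (Fin 4) (Fin 4) (PadicAlgCl p)) (ν : Γ → PadicAlgCl p),
      (∀ g, (σ g).val.det = d g) → (∀ g, (σ' g).val.det = d g) →
      (∀ g, Matrix.GeneralLinearGroup.map (Valued.integer (PadicAlgCl p)).subtype (rint g) = P⁻¹ * r g * P) →
      (∀ g, (Matrix.GeneralLinearGroup.map red (rint g)).val =
          h.val * Matrix.reindex finSumFinEquiv finSumFinEquiv
            (Matrix.fromBlocks (σ g).val (B g) 0 (σ' g).val) * (h⁻¹).val) →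
      Jᵀ = -J → J.det ≠ 0 → (∀ g, (r g).valᵀ * J * (r g).val = ν g • J) →
      (∀ g, ∃ u : Valued.integer (PadicAlgCl p), (u : PadicAlgCl p) = ν g ∧ red u = d g) →
      ∃ (P₂ : GL (Fin 4) (PadicAlgCl p))
        (rint₂ : Γ →* GL (Fin 4) (Valued.integer (PadicAlgCl p))) (h₂ : GL (Fin 4) k),
        (∀ g, Matrix.GeneralLinearGroup.map (Valued.integer (PadicAlgCl p)).subtype (rint₂ g) = P₂⁻¹ * r g * P₂) ∧
        (∀ g, (Matrix.GeneralLinearGroup.map red (rint₂ g)).val =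
          h₂.val * Matrix.reindex finSumFinEquiv finSumFinEquiv
            (Matrix.fromBlocks (σ' g).val
              (-(((d g)⁻¹ : kˣ) : k) • ((σ' g).val * (B g).adjugate * (σ g).val)) 0 (σ g).val) * (h₂⁻¹).val) := by
  intro p _ k _ Γ _ red σ σ' d B r P rint h J ν hσ hσ' hP hred _hJT hJdet hsymp hunit
  -- (0) the multiplier: `ν` multiplicative, `ν 1 = 1`; its integral lift `u` likewise
  have hJu : IsUnit J.det := isUnit_iff_ne_zero.mpr hJdet
  have hJ0 : J ≠ 0 := fun h0 => hJdet (by rw [h0, Matrix.det_zero])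
  obtain ⟨hνmul, hν1⟩ := multiplier_mul_one r J ν hJ0 hsymp
  choose u hu using hunit
  have humul : ∀ a b, u (a * b) = u a * u b := fun a b => Subtype.ext <| by
    rw [Subring.coe_mul, (hu (a * b)).1, (hu a).1, (hu b).1, hνmul]
  have hu1 : u 1 = 1 := Subtype.ext <| by rw [(hu 1).1, hν1, Subring.coe_one]
  -- (1) the dual frame `rint₂ g = u g • (rint g)⁻ᵀ`, a homomorphism `Γ → M₄(ℤ̄_p)`, hence `Γ → GL₄(ℤ̄_p)`
  let f : Γ →* Matrix (Fin 4) (Fin 4) (Valued.integer (PadicAlgCl p)) :=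
    { toFun := fun g => u g • ((rint g)⁻¹).valᵀ
      map_one' := by simp only [map_one, inv_one, Units.val_one, Matrix.transpose_one, hu1, one_smul]
      map_mul' := fun a b => by
        rw [map_mul, mul_inv_rev, Units.val_mul, Matrix.transpose_mul, humul, Matrix.smul_mul, Matrix.mul_smul,
          smul_smul] }
  obtain ⟨rint₂, hrint₂⟩ : ∃ rint₂ : Γ →* GL (Fin 4) (Valued.integer (PadicAlgCl p)),
      ∀ g, (rint₂ g).val = u g • ((rint g)⁻¹).valᵀ := ⟨f.toHomUnits, fun g => rfl⟩
  have hmapval : ∀ {S : Type} [CommRing S] (φ : Valued.integer (PadicAlgCl p) →+* S)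
      (x : GL (Fin 4) (Valued.integer (PadicAlgCl p))), (Matrix.GeneralLinearGroup.map φ x).val = x.val.map φ :=
    fun _ _ => rfl
  -- (2) the dual conjugator `P₂ = J⁻¹ P⁻ᵀ`, `P₂⁻¹ = Pᵀ J`
  obtain ⟨P₂, hP₂, hP₂'⟩ : ∃ P₂ : GL (Fin 4) (PadicAlgCl p),
      P₂.val = J⁻¹ * (P⁻¹).valᵀ ∧ (P₂⁻¹).val = P.valᵀ * J := by
    refine ⟨⟨J⁻¹ * (P⁻¹).valᵀ, P.valᵀ * J, ?_, ?_⟩, rfl, rfl⟩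
    · rw [Matrix.mul_assoc, ← Matrix.mul_assoc _ _ J, ← Matrix.transpose_mul, Units.mul_inv, Matrix.transpose_one,
        Matrix.one_mul, Matrix.nonsing_inv_mul J hJu]
    · rw [Matrix.mul_assoc, ← Matrix.mul_assoc J, Matrix.mul_nonsing_inv J hJu, Matrix.one_mul,
        ← Matrix.transpose_mul, Units.inv_mul, Matrix.transpose_one]
  -- (3) the residual conjugator `h₂ = h⁻ᵀ E`, `h₂⁻¹ = E' hᵀ`
  have hadj : ∀ A : Matrix (Fin 2) (Fin 2) k, !![(0 : k), -1; 1, 0] * Aᵀ * !![(0 : k), 1; -1, 0] = A.adjugate :=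
    J₂inv_mul_transpose_mul_J₂
  obtain ⟨h₂, hh₂, hh₂'⟩ : ∃ h₂ : GL (Fin 4) k,
      h₂.val = (h⁻¹).valᵀ * Matrix.reindex finSumFinEquiv finSumFinEquiv
          (Matrix.fromBlocks 0 !![(0 : k), 1; -1, 0] !![(0 : k), 1; -1, 0] 0) ∧
        (h₂⁻¹).val = Matrix.reindex finSumFinEquiv finSumFinEquiv
          (Matrix.fromBlocks 0 !![(0 : k), -1; 1, 0] !![(0 : k), -1; 1, 0] 0) * h.valᵀ := by
    refine ⟨⟨(h⁻¹).valᵀ * Matrix.reindex finSumFinEquiv finSumFinEquiv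
          (Matrix.fromBlocks 0 !![(0 : k), 1; -1, 0] !![(0 : k), 1; -1, 0] 0),
        Matrix.reindex finSumFinEquiv finSumFinEquiv
          (Matrix.fromBlocks 0 !![(0 : k), -1; 1, 0] !![(0 : k), -1; 1, 0] 0) * h.valᵀ, ?_, ?_⟩, rfl, rfl⟩
    · rw [Matrix.mul_assoc, ← Matrix.mul_assoc _ _ h.valᵀ, reindex_swapTwist_mul _ _ _ J₂_mul_J₂',
        Matrix.one_mul, ← Matrix.transpose_mul, Units.mul_inv, Matrix.transpose_one]
    · rw [Matrix.mul_assoc, ← Matrix.mul_assoc h.valᵀ, ← Matrix.transpose_mul, Units.inv_mul, Matrix.transpose_one,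
        Matrix.one_mul, reindex_swapTwist_mul _ _ _ (mul_eq_one_comm.mp J₂_mul_J₂')]
  refine ⟨P₂, rint₂, h₂, fun g => ?_, fun g => ?_⟩
  · -- the frame identity over `ℚ̄_p`
    have hinv : Matrix.GeneralLinearGroup.map (Valued.integer (PadicAlgCl p)).subtype (rint g)⁻¹ =
        P⁻¹ * (r g)⁻¹ * P := by
      rw [map_inv, hP g, mul_inv_rev, mul_inv_rev, inv_inv, mul_assoc]
    have hval : ((rint g)⁻¹).val.map (Valued.integer (PadicAlgCl p)).subtype =
        (P⁻¹).val * ((r g)⁻¹).val * P.val := by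
      have e := congrArg Units.val hinv
      rw [Units.val_mul, Units.val_mul] at e
      exact e
    apply Units.ext
    rw [Units.val_mul, Units.val_mul, hmapval, hrint₂ g, hP₂, hP₂',
      Matrix.map_smul' _ _ _ (map_mul (Valued.integer (PadicAlgCl p)).subtype), Matrix.transpose_map, hval,
      Subring.coe_subtype, (hu g).1]
    exact dual_frame_transport (r g).val ((r g)⁻¹).val P.val (P⁻¹).val J (ν g) hJu (Units.mul_inv (r g)) (hsymp g)
  · -- the residual identity
    have hYX : ((rint g)⁻¹).val.map red * (rint g).val.map red = 1 := by
      rw [← Matrix.map_mul, Units.inv_mul, Matrix.map_one _ (map_zero red) (map_one red)]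
    rw [hmapval, hrint₂ g, Matrix.map_smul' _ _ _ (map_mul red), Matrix.transpose_map, (hu g).2, hh₂, hh₂']
    exact residual_dualFrame finSumFinEquiv _ _ (σ g).val (σ' g).val (B g) (d g) hadj J₂_mul_J₂' (hσ g) (hσ' g)
      h.val (h⁻¹).val _ _ (Units.mul_inv h) (Units.inv_mul h) (hred g) hYX

end Summit.Langlands.Langlands.Cruxes.ResiduallyYoshidaLifting.SectorKlingenSplit.Fibre

end
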